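import Mathlib

/-!
# Sign-fibres of zero-sum-free sequences over `𝔽₃` are cap sets (solo-blind seat, s69)

Solo-blind lane `MatrixMultiplication`, door I1⁗ / the Kraft conjecture `(K₃)` (HOME `paper/KraftK3.md`).
For a sequence `h : Fin n → G` in a `ZMod 3`-module `G` put
`Q_h(x) := ∑ i, (x i)^2 • h i` for `x : Fin n → ZMod 3` (the *diagonal quadratic map* of `h`;
since `a^2 ∈ {0,1}` in `ZMod 3`, `Q_h(x)` is the sub-sum of `h` over the support of `x`).

* `soloBlind_quad_eq_sum_support` : `Q_h(x) = ∑_{i : x i ≠ 0} h i`.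
* `soloBlind_aniso_iff_zsf` : `Q_h` is anisotropic (`Q_h x = 0 → x = 0`) iff `h` is zero-sum free
  (no non-empty `T` with `∑_{i ∈ T} h i = 0`).
* `soloBlind_quad_three_points` : the polarisation identity
  `Q(x) + Q(x+u+u) = Q(x+u) + Q(x+u) + (Q(u) + Q(u))`.
* `soloBlind_fibre_noLine` : if `Q_h` is anisotropic and `u ≠ 0`, the three points
  `x, x+u, x+u+u` of an affine line never lie in one fibre of `Q_h`.
* `soloBlind_fibre_capset` : hence every fibre is a cap set: three pairwise distinct points of a
  fibre never sum to `0`.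

Consequence recorded in HOME `paper/KraftK3.md` §7: `(K₃)` ⟺ every fibre of `Q_h` (`h` zsf in `𝔽₃^r`)
has at most `2^n` points; fibres are symmetric caps (`±` lifts of caps of `PG(n-1,3)`), so the
cap relaxation alone gives only `2·m₂(n-1,3)` (`= 20 > 16` at `n = 4`, the elliptic-quadric cone).
No `sorry`, standard axioms.
-/

namespace Summit.MatrixMultiplication.MatrixMultiplication.Theorems

open Finset

variable {n : ℕ} {G : Type*} [AddCommGroup G] [Module (ZMod 3) G]

/-- The diagonal quadratic map `x ↦ ∑ i, (x i)^2 • h i` of a sequence `h`. -/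
def soloBlindQuad (h : Fin n → G) (x : Fin n → ZMod 3) : G := ∑ i, (x i) ^ 2 • h i

omit [Module (ZMod 3) G] in
/-- In a `ZMod 3`-module every element is killed by `3`. -/
theorem soloBlind_three_torsion [Module (ZMod 3) G] (y : G) : y + y + y = 0 := by
  have h3 : (3 : ℕ) • y = 0 := by
    rw [← Nat.cast_smul_eq_nsmul (ZMod 3)]
    have : ((3 : ℕ) : ZMod 3) = 0 := by decide
    rw [this, zero_smul]
  have : (3 : ℕ) • y = y + y + y := by
    rw [show (3 : ℕ) = 2 + 1 from rfl, succ_nsmul, two_nsmul]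
  rw [← this]; exact h3

/-- In `ZMod 3`, `a^2 • y` is `0` for `a = 0` and `y` otherwise (`a^2 ∈ {0,1}`). -/
theorem soloBlind_sq_smul (a : ZMod 3) (y : G) : a ^ 2 • y = if a = 0 then 0 else y := by
  by_cases ha : a = 0
  · simp [ha]
  · have hsq : ∀ b : ZMod 3, b ≠ 0 → b ^ 2 = 1 := by decide
    rw [hsq a ha, one_smul, if_neg ha]

/-- `Q_h(x)` is the sub-sum of `h` over the support of `x`. -/
theorem soloBlind_quad_eq_sum_support (h : Fin n → G) (x : Fin n → ZMod 3) :
    soloBlindQuad h x = ∑ i ∈ univ.filter (fun i => x i ≠ 0), h i := by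
  unfold soloBlindQuad
  rw [Finset.sum_filter]
  refine Finset.sum_congr rfl (fun i _ => ?_)
  rw [soloBlind_sq_smul]
  by_cases hx : x i = 0 <;> simp [hx]

/-- Anisotropy of `Q_h` is equivalent to zero-sum-freeness of `h`. -/
theorem soloBlind_aniso_iff_zsf (h : Fin n → G) :
    (∀ x : Fin n → ZMod 3, soloBlindQuad h x = 0 → x = 0) ↔
      (∀ T : Finset (Fin n), T.Nonempty → ∑ i ∈ T, h i ≠ 0) := by
  constructor
  · intro han T hT hsum
    -- indicator vector of T
    let x : Fin n → ZMod 3 := fun i => if i ∈ T then 1 else 0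
    have hx : soloBlindQuad h x = 0 := by
      rw [soloBlind_quad_eq_sum_support]
      have : univ.filter (fun i => x i ≠ 0) = T := by
        ext i; simp [x]
      rw [this]; exact hsum
    have := han x hx
    obtain ⟨i, hi⟩ := hT
    have : x i = 0 := by rw [this]; rfl
    simp [x, hi] at this
  · intro hz x hx
    rw [soloBlind_quad_eq_sum_support] at hx
    by_contra hne
    have : (univ.filter (fun i => x i ≠ 0)).Nonempty := by
      rw [Finset.filter_nonempty_iff]
      by_contra hall
      push Not at hall
      apply hne; funext i; simpa using hall i (mem_univ i)
    exact hz _ this hx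

/-- Polarisation along an affine line: `Q(x) + Q(x+2u) = 2Q(x+u) + 2Q(u)`, written additively. -/
theorem soloBlind_quad_three_points (h : Fin n → G) (x u : Fin n → ZMod 3) :
    soloBlindQuad h x + soloBlindQuad h (x + u + u) =
      soloBlindQuad h (x + u) + soloBlindQuad h (x + u) + (soloBlindQuad h u + soloBlindQuad h u) := by
  unfold soloBlindQuad
  simp only [Pi.add_apply]
  rw [← Finset.sum_add_distrib, ← Finset.sum_add_distrib, ← Finset.sum_add_distrib,
    ← Finset.sum_add_distrib]
  refine Finset.sum_congr rfl (fun i _ => ?_)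
  rw [← add_smul, ← add_smul, ← add_smul, ← add_smul]
  congr 1
  ring

/-- A fibre of an anisotropic diagonal quadratic map contains no affine line `{x, x+u, x+2u}`. -/
theorem soloBlind_fibre_noLine (h : Fin n → G)
    (han : ∀ x : Fin n → ZMod 3, soloBlindQuad h x = 0 → x = 0)
    (x u : Fin n → ZMod 3) (hu : u ≠ 0)
    (h1 : soloBlindQuad h (x + u) = soloBlindQuad h x)
    (h2 : soloBlindQuad h (x + u + u) = soloBlindQuad h x) : False := by
  have key := soloBlind_quad_three_points h x u
  rw [h1, h2] at key
  -- key : Q x + Q x = Q x + Q x + (Q u + Q u)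
  have hQu : soloBlindQuad h u + soloBlindQuad h u = 0 := by
    have := key
    rw [left_eq_add] at this   -- a = a + b ↔ b = 0
    exact this
  have hQ : soloBlindQuad h u = 0 := by
    have t := soloBlind_three_torsion (soloBlindQuad h u)
    rw [hQu, zero_add] at t
    exact t
  exact hu (han u hQ)

/-- Hence every fibre is a cap set: no three pairwise distinct points of a fibre sum to zero. -/
theorem soloBlind_fibre_capset (h : Fin n → G)
    (han : ∀ x : Fin n → ZMod 3, soloBlindQuad h x = 0 → x = 0)
    (a b c : Fin n → ZMod 3) (hab : a ≠ b)
    (hb : soloBlindQuad h b = soloBlindQuad h a) (hc : soloBlindQuad h c = soloBlindQuad h a)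
    (habc : a + b + c = 0) : False := by
  -- the line through a and b is {a, a+u, a+u+u} with u = b - a, and a+u+u = c
  set u : Fin n → ZMod 3 := b - a with hu_def
  have hu : u ≠ 0 := by
    intro h0; apply hab
    have : b - a = 0 := h0
    exact (sub_eq_zero.mp this).symm
  have e1 : a + u = b := by rw [hu_def]; abel
  have e2 : a + u + u = c := by
    funext i
    have hi := congrFun habc i
    simp only [Pi.add_apply, Pi.zero_apply] at hi
    simp only [hu_def, Pi.add_apply, Pi.sub_apply]
    have key : ∀ p q r : ZMod 3, p + q + r = 0 → p + (q - p) + (q - p) = r := by decide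
    exact key _ _ _ hi
  exact soloBlind_fibre_noLine h han a u hu (by rw [e1, hb]) (by rw [e2, hc])

end Summit.MatrixMultiplication.MatrixMultiplication.Theorems
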